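import Summits.BirchSwinnertonDyer.BirchSwinnertonDyer.Theorems.ResidualThetaTransportAtTwoResidualSignedLambdaLowerCMAtTwoCofreeAdmissible
import Summits.BirchSwinnertonDyer.BirchSwinnertonDyer.Theorems.ResidualThetaTransportAtTwoResidualSignedLambdaLowerCMAtTwoCofreeShapiroTransport
import Summits.BirchSwinnertonDyer.BirchSwinnertonDyer.Theorems.ResidualThetaTransportAtTwoThetaTransportResidualUnramified
import Summits.BirchSwinnertonDyer.BirchSwinnertonDyer.Theorems.ResidualThetaTransportAtTwoThetaTransportResidualArchimedean
import Summits.BirchSwinnertonDyer.BirchSwinnertonDyer.Theorems.ResidualThetaTransportAtTwoUnramifiedRestriction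
import Literature.NumberTheory.GaloisRepresentations.EulerSystemGaloisAction
import Literature.NumberTheory.GaloisRepresentations.DecompositionGroupOfCompletion
import Literature.NumberTheory.GaloisRepresentations.OneCocycleRestrictionKernelCountProofs
import HarnessLib

/-!
# Stub-ideation k3·g13 (technique: DECOMPOSITION with a PROVED glue) for `stub_cmLambdaLower` = RSL_g
# `ResidualSignedLambdaLowerCMAtTwo` (stmt-BirchSwinnertonDyer-22608), crux (R≥)ᵖ `ResidualThetaCountLowerPureAtTwo`
# (stmt-BirchSwinnertonDyer-26074), skeleton `Lines/bt26_lambda.lean` v6.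

## THE PIECE DECOMPOSED: the `ρ`-coefficient TRANSFER (T)_ρ shared by items 6/7 of the v2b split
(`stub_deepHalfAtTwoStrict` S4₂ / `stub_deepHalfAwayTwo` S4₀ of `Lines/onepair.lean`).

Both items carry a Λ-adic hypothesis quantified over the RELAXED Selmer set over `ℚ_∞`
(`∀ s : ↥SelRel, c₂ z (loc₂ s) = 0`, resp. `∀ s : ↥SelRel, loc₂ s = 0 → cS χ (locS s) = 0`), while their
interior (STUB-PLAN rev 17 §3.3: «ONE `SelmerComplement` call per `(n,k)` over `K = ℚ` on
`Maps(Γ_ℚ ⧸ Γ_n, A_ρ[2^k])`», then Kőnig `ThetaTransport.exists_iwasawaH1_of_levelwise[_from]`, then UN_ρ)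
needs hypothesis (ii) of `SelmerComplement` at EVERY level `(n,k)`: orthogonality of the local datum to the
localisations of every class of the DUAL Selmer structure.  Between the two stands the transfer
`τ_{n,N} := res_{Γ_∞ ≤ Γ_n} ∘ (A_ρ[N] ↪ A_ρ)_* : H¹(Γ_n, A_ρ[N]) → H¹(Γ_∞, A_ρ)` and the statement

  (T)_ρ  «a level class whose Shapiro lift lies in the dual structure — i.e. (E1a) ADMISSIBLE outside
         `S' ⊆ S₀ ∪ {v ∣ p}`, (E1c) all conjugates trivial on `Γ_n ∩ D_w` for `w ∣ ∞`, and (item 7 only, E1b)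
         all conjugates trivial on `Γ_n ∩ D_v` for `v ∣ p` — is carried by `τ` INTO the relaxed set:
         clause (1) `unramifiedOutside Γ_∞ A_ρ p S₀`, clause (2) `∀ w σ, conj_σ · ∈ infKer Γ_∞ A_ρ w`
         (VERBATIM the first two clauses of RSL_g's counted set / of `hsup`'s `Sg` in `…OfParts`), and
         (3′) `∀ σ, conj_σ · ∈ awayKer Γ_∞ A_ρ v` («`loc₂ s = 0`» in its strongest Galois-side form).»

It is the `ρ`/`Cofree` twin of TP2's `…PTDeepTransfer.lean` (T) + `…PTDeepTransferTools.lean` §2–§3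
(W-coefficients, `E[p^k] ↪ E[p^∞]`, `layerToInfty`), which has NO counterpart in the RTT tree (the landed
`…CofreeShapiroTransport.lean` stops at the level-`Γ_n` clauses (E1a/b/c); `…CofreeAdmissible.lean` is the
admissible-set bookkeeping).  The hypotheses below are LITERALLY the conclusions of
`ThetaTransport.ShapiroTransport.admissible_of_forall_localization_shapiroLift_mem` (E1a),
`…resOfLe_decompInf_conjH1_eq_zero_of_localization_shapiroLift_eq_zero` (E1c),
`…resOfLe_decomp_conjH1_eq_zero_of_localization_shapiroLift_eq_zero` (E1b).

## DECOMPOSITION (every piece PROVED here, 0 sorry; `p`, `d`, `κ`, `N` generic — no `2`, no `Θ`, no pins)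
* §1 `transferH1` — the map `τ` (an `abbrev`; a THEOREMS-ONLY landing spells the composite).
* §2 T1 [unr]: B1 `mem_unramifiedKer_of_resOfLe_inertia_inf_eq_zero` (cocycle bridge, any `H`),
  L1 `mem_unramifiedOutside_of_admissible` — **Kato ⟹ Greenberg–Vatsal**, the CONVERSE of the landed
  `ThetaTransport.admissible_of_mem_unramifiedOutside` —, then `transferH1_mem_unramifiedOutside`
  (push: `ThetaTransport.pushH1_mem_unramifiedOutside`; restrict: `ResidualLayer.resOfLe_mem_unramifiedOutside`).
* §3 RES-PUSH-ZERO `resOfLe_inf_transferH1_conjH1_eq_zero` (generic subgroup `D`): «`conj_σ b` dies on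
  `Γ_n ⊓ D` ⟹ `conj_σ (τ b)` dies on `Γ_∞ ⊓ D`» (`resOfLe_comp_conjH1_holds`, `ThetaTransport.conjH1_pushH1`,
  `ThetaTransport.resOfLe_pushH1`, `resOfLe_comp_holds`); T2 [inf] `conjH1_transferH1_mem_infKer` and
  T3 [at p] `conjH1_transferH1_mem_awayKer` are its instances `D = decompInf w`, `D = decomp v`.
  Item 7 bonus: B2 `exists_rep_vanishing_of_resOfLe_inf_eq_zero` + `exists_rep_vanishing_conjH1_transferH1` (a representative
  VANISHING on `Γ_∞ ∩ D_v`) + B3 `kummer_identity_zero_point`: RSL_g's Kummer clause (3)/(3♭) then holds with the zero points.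
  Item 6 residue T3♭ [kum-relaxed over `ℚ_{∞,2}`] = «Kummer = everything at a supersingular prime of the cyclotomic tower»
  (`WeierstrassCurve.localKerOver_kerSubgroup_eq_top_of_supersingular` behind the named fact `CoatesGreenberg1996_H1_formalGroup_trivial`)
  read through `Θ` — pins-dependent, NOT typed here (the one arithmetic sub-stub of the decomposition; see the card).
* §4 (T)_ρ assembled: `transferH1_mem_relaxed` (items 6 and 7) and `transferH1_mem_relaxed_strict` (item 7).
* §4b composite with the landed Shapiro transports: `transferH1_mem_relaxed[_strict]_of_shapiroLift` — hypotheses = LOCAL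
  CONDITIONS on `Sh c ∈ H¹(ℚ, Maps(Γ_ℚ ⧸ Γ_n, A_ρ[N]))` (membership in the DUAL structure of the level call), conclusion =
  `τ c ∈` relaxed set over `ℚ_∞` [+ strict at `p`].
* §5 GLUE to the levelwise hypothesis (ii): `levelwise_orthogonal_of_transfer` — Λ-adic orthogonality over
  the relaxed set + (T)_ρ + the pairing READBACK (R) ⟹ levelwise orthogonality; (R) is the pins-dependent
  piece (T4, typed abstractly here; concrete once the lead's wrapper-defs S62 land).
* §6 `N • τ b = 0` (the transferred classes are `N`-torsion; bookkeeping for `Sg[ϖ^k]`-typed consumers).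

HONEST FRAMING: Galois-cohomological plumbing; nothing about any count, `L`-value or Selmer corank is
asserted; RSL_g (22608) and (R≥)ᵖ (26074) stay OPEN; BSD is NOT proved by any of this.
References: [GreenbergVatsal2000] §2 pp. 16–17, 23; [Greenberg1989] §1 p. 98 (3); [Kato2004Asterisque]
§8.2 (p. 181), §13.8; [NeukirchSchmidtWingberg2008] I §5 (1.5.2)–(1.5.4); [SerreGaloisCohomology1997]
I §2.4–2.5, §5.1; [MilneADT2006] I 4.10 (b); [Rubin2000] App. B §B.3; [PerrinRiou1994Asterisque229] §1.3.
-/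

set_option autoImplicit false
set_option linter.dupNamespace false

noncomputable section

open scoped Classical NumberField

namespace Summit.BirchSwinnertonDyer.BirchSwinnertonDyer.Cruxes.ResidualThetaCountLowerPureAtTwo.StubIdeasK3G13

open Field IsDedekindDomain NumberField
  Literature.NumberTheory.EllipticCurves Literature.NumberTheory.GaloisRepresentations
  Literature.NumberTheory.EllipticCurves.GreenbergSelmer Literature.NumberTheory.EllipticCurves.GreenbergVatsal2000
  Literature.NumberTheory.EllipticCurves.Kato2004 ZpExtension
  Summit.BirchSwinnertonDyer.BirchSwinnertonDyer.Theorems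

/-! ## §0 Generic bridges (any number field `K`, any `H ≤ Γ_K`, any discrete `Γ_K`-module) -/

section Generic

universe u

variable {K : Type u} [Field K] [NumberField K]
  {M : Type u} [AddCommGroup M] [DistribMulAction (absoluteGaloisGroup K) M] [TopologicalSpace M] [DiscreteTopology M]
  {M' : Type u} [AddCommGroup M'] [DistribMulAction (absoluteGaloisGroup K) M'] [TopologicalSpace M'] [DiscreteTopology M']

/-- **B1 (cocycle bridge).** If `c ∈ H¹(H, M)` dies on `H ⊓ I` for a subgroup `I ⊇ I_v = GreenbergSelmer.inertia v`
(e.g. `I = I_{𝔓₀(v)}`, the inertia group of the completion prime), then `c ∈ unramifiedKer H M v`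
(both sides say «the cocycle is a coboundary on `H ∩ I_v`»). [cite: GreenbergVatsal2000, §2 p. 17] [cite: SerreGaloisCohomology1997, I §5.1] -/
theorem mem_unramifiedKer_of_resOfLe_inertia_inf_eq_zero (H : Subgroup (absoluteGaloisGroup K))
    (v : HeightOneSpectrum (𝓞 K)) {I : Subgroup (absoluteGaloisGroup K)} (hI : GreenbergSelmer.inertia (K := K) v ≤ I)
    {c : subgroupH1 H M} (hc : resOfLe M (inf_le_left : H ⊓ I ≤ H) c = 0) :
    c ∈ unramifiedKer H M v := by
  obtain ⟨φ, rfl⟩ := oneCocycleClass_surjective _ c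
  rw [CocycleCriteria.resOfLe_oneCocycleClass_eq_zero_iff] at hc
  obtain ⟨a, ha⟩ := hc
  rw [ResidualLayer.oneCocycleClass_mem_unramifiedKer_iff]
  refine ⟨a, fun x ↦ ?_⟩
  obtain ⟨hxH, hxI⟩ := (mem_inertiaIn_iff H v _).1 x.2
  have h := ha ⟨((x : decomp (K := K) v) : absoluteGaloisGroup K), Subgroup.mem_inf.2 ⟨hxH, hI hxI⟩⟩
  have e : inertiaInToH H v x =
      Subgroup.inclusion (inf_le_left : H ⊓ I ≤ H)
        ⟨((x : decomp (K := K) v) : absoluteGaloisGroup K), Subgroup.mem_inf.2 ⟨hxH, hI hxI⟩⟩ :=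
    Subtype.ext rfl
  rw [e, h]
  rfl

omit [NumberField K] in
/-- **RES-PUSH-ZERO (generic).** For `H₀ ≤ H ≤ Γ_K` (`H` normal), a subgroup `D ≤ Γ_K` and an equivariant
`i : M → M'`: if `y ∈ H¹(H, M)` dies on `H ⊓ D` then `res_{H₀} (i_* y)` dies on `H₀ ⊓ D`.
[cite: SerreGaloisCohomology1997, I §2.4] [cite: NeukirchSchmidtWingberg2008, I §5] -/
theorem resOfLe_inf_resOfLe_pushH1_eq_zero {H H₀ : Subgroup (absoluteGaloisGroup K)} [H.Normal] (h : H₀ ≤ H)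
    (D : Subgroup (absoluteGaloisGroup K)) (i : M →+ M') (hi : ∀ (g : absoluteGaloisGroup K) (x : M), i (g • x) = g • i x)
    {y : subgroupH1 H M} (hy : resOfLe M (inf_le_left : H ⊓ D ≤ H) y = 0) :
    resOfLe M' (inf_le_left : H₀ ⊓ D ≤ H₀) (resOfLe M' h (pushH1 H i hi y)) = 0 := by
  -- `res_{H₀ ⊓ D}^{H₀} ∘ res_{H₀}^{H} = res_{H₀ ⊓ D}^{H ⊓ D} ∘ res_{H ⊓ D}^{H}`
  have e1 := congrArg (fun f ↦ f (pushH1 H i hi y)) (resOfLe_comp_holds (M := M') (inf_le_left : H₀ ⊓ D ≤ H₀) h)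
  have e2 := congrArg (fun f ↦ f (pushH1 H i hi y)) (resOfLe_comp_holds (M := M')
    (inf_le_inf_right D h : H₀ ⊓ D ≤ H ⊓ D) (inf_le_left : H ⊓ D ≤ H))
  simp only [AddMonoidHom.coe_comp, Function.comp_apply] at e1 e2
  rw [e1, ← e2, ThetaTransport.resOfLe_pushH1 i hi inf_le_left y, hy, map_zero, map_zero]

omit [NumberField K] in
/-- `conj_σ ∘ res = res ∘ conj_σ` applied to a class. [cite: NeukirchSchmidtWingberg2008, I §5] -/
theorem conjH1_resOfLe {H H₀ : Subgroup (absoluteGaloisGroup K)} [H.Normal] [H₀.Normal] (h : H₀ ≤ H)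
    (σ : absoluteGaloisGroup K) (y : subgroupH1 H M) :
    conjH1 H₀ M σ (resOfLe M h y) = resOfLe M h (conjH1 H M σ y) := by
  have e := congrArg (fun f ↦ f y) (resOfLe_comp_conjH1_holds (M := M) h σ)
  simp only [AddMonoidHom.coe_comp, Function.comp_apply] at e
  exact e.symm

omit [NumberField K] in
/-- **B2 (normalised representative).** If the stabilisers of `M` are open and `y ∈ H¹(H, M)` dies on `H ⊓ D`, then `y` has a
representative cocycle VANISHING on `H ⊓ D` (subtract the principal cocycle; `exists_oneCocycleClass_eq_and_forall_mem_eq_zero`).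
Use (item 7, clause (3)/(3♭) of RSL_g's sets): with such a representative `ψ` of `conj_σ (τ b) ∈ awayKer Γ_∞ A_ρ v` the Kummer
identity `Θ(ψ(r τ)) ↦ τ • Q − Q` holds with the ZERO points `Q = 0` (B3), so a class strict at `2` satisfies even the SIGNED clause.
[cite: SerreGaloisCohomology1997, I §2.6 (b)] [cite: Greenberg1989, §1 p. 98] -/
theorem exists_rep_vanishing_of_resOfLe_inf_eq_zero (H D : Subgroup (absoluteGaloisGroup K))
    (hM : ∀ m : M, IsOpen (MulAction.stabilizer (absoluteGaloisGroup K) m : Set (absoluteGaloisGroup K)))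
    {y : subgroupH1 H M} (hy : resOfLe M (inf_le_left : H ⊓ D ≤ H) y = 0) :
    ∃ ψ : contOneCocycles (discreteTopRep H M), oneCocycleClass _ ψ = y ∧
      ∀ g : H, (g : absoluteGaloisGroup K) ∈ D → ψ.1 g = 0 := by
  obtain ⟨φ, rfl⟩ := oneCocycleClass_surjective _ y
  rw [CocycleCriteria.resOfLe_oneCocycleClass_eq_zero_iff] at hy
  obtain ⟨a, ha⟩ := hy
  have hX : ∀ v : M, Continuous fun g : H ↦ (discreteTopRep H M).ρ g v := fun v ↦
    ((continuous_smul_of_isOpen_stabilizer v (hM v)).comp continuous_subtype_val).congr fun _ ↦ rfl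
  have hφ : ∃ φ' : contOneCocycles (discreteTopRep H M), oneCocycleClass _ φ' = oneCocycleClass _ φ ∧
      ∃ v : M, ∀ s ∈ D.subgroupOf H, φ'.1 s = (discreteTopRep H M).ρ s v - v := by
    refine ⟨φ, rfl, a, fun s hs ↦ ?_⟩
    have h := ha ⟨(s : absoluteGaloisGroup K), Subgroup.mem_inf.2 ⟨s.2, Subgroup.mem_subgroupOf.1 hs⟩⟩
    have e : Subgroup.inclusion (inf_le_left : H ⊓ D ≤ H)
        ⟨(s : absoluteGaloisGroup K), Subgroup.mem_inf.2 ⟨s.2, Subgroup.mem_subgroupOf.1 hs⟩⟩ = s := Subtype.ext rfl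
    rw [e] at h
    exact h
  obtain ⟨ψ, hψ, h0⟩ := exists_oneCocycleClass_eq_and_forall_mem_eq_zero hX (D.subgroupOf H) hφ
  exact ⟨ψ, hψ, fun g hg ↦ h0 g (Subgroup.mem_subgroupOf.2 hg)⟩

omit [NumberField K] in
/-- **B3 (the Kummer identity with the zero point).** For a representative `ψ` vanishing on the image of the local Galois group
`r : G_v → H`, any read-out `Θ` with `Θ 0 = 0` into points `P` satisfies `Θ (ψ (r τ)) = τ • 0 − 0` — the shape of RSL_g's
clause (3) `pointsMapOfEmb (Θ v hv (φ.1 (resGalSubgroupOfEmb … τ)) i) = τ • Q i − Q i` with `Q = 0` (and `2^k • 0` lies in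
every subgroup). [cite: Greenberg1989, §1 p. 98] -/
theorem kummer_identity_zero_point {H : Subgroup (absoluteGaloisGroup K)} {Gv P : Type*} [Monoid Gv] [AddCommGroup P]
    [DistribMulAction Gv P] (ψ : contOneCocycles (discreteTopRep H M)) (r : Gv → H) (Θ : M → P) (hΘ : Θ 0 = 0)
    (hψ : ∀ τ, ψ.1 (r τ) = 0) (τ : Gv) : Θ (ψ.1 (r τ)) = τ • (0 : P) - 0 := by
  rw [hψ, hΘ, smul_zero, sub_zero]

end Generic

/-! ## §1 The transfer map `τ_{n,N} = res_{Γ_∞ ≤ Γ_n} ∘ (A_ρ[N] ↪ A_ρ)_*` -/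

variable {p : ℕ} [Fact p.Prime] (S : Set (PadicAlgCl p)) {d : ℕ} (ρ : FramedGaloisRep ℚ ↥(padicCoeffIntegers S) d)
  (κ : ZpExtension ℚ p) (N : ℤ) (n : ℕ)

/-- The inclusion `A_ρ[N] ↪ A_ρ` is `Γ_ℚ`-equivariant. [cite: SerreGaloisCohomology1997, I §2.1] -/
theorem torsionBy_subtype_smul (g : absoluteGaloisGroup ℚ) (x : ↥(AddSubgroup.torsionBy (Cofree ρ ↥(padicCoeffField S)) N)) :
    (AddSubgroup.torsionBy (Cofree ρ ↥(padicCoeffField S)) N).subtype (g • x) =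
      g • (AddSubgroup.torsionBy (Cofree ρ ↥(padicCoeffField S)) N).subtype x :=
  rfl

/-- **`τ_{n,N} : H¹(Γ_n, A_ρ[N]) → H¹(Γ_∞, A_ρ)`** — push along `A_ρ[N] ↪ A_ρ`, then restrict to `Γ_∞ = ker κ`
(TP2's `layerToInfty ∘ push`). [cite: PerrinRiou1994Asterisque229, §1.3] [cite: NeukirchSchmidtWingberg2008, I §5] -/
abbrev transferH1 : subgroupH1 (κ.layerSubgroup n) ↥(AddSubgroup.torsionBy (Cofree ρ ↥(padicCoeffField S)) N) →+
    subgroupH1 κ.kerSubgroup (Cofree ρ ↥(padicCoeffField S)) :=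
  (resOfLe (Cofree ρ ↥(padicCoeffField S)) (κ.kerSubgroup_le_layerSubgroup n)).comp
    (pushH1 (κ.layerSubgroup n) (AddSubgroup.torsionBy (Cofree ρ ↥(padicCoeffField S)) N).subtype
      (torsionBy_subtype_smul S ρ N))

/-! ## §2 T1 [unr]: admissible ⟹ `τ b ∈ unramifiedOutside Γ_∞ A_ρ p S₀` -/

/-- **L1 (Kato ⟹ Greenberg–Vatsal; converse of `ThetaTransport.admissible_of_mem_unramifiedOutside`).** A class of
`H¹(H, A_ρ[N])` (`H` normal) dying on `H ⊓ I_𝔓` for EVERY prime `𝔓 ∣ v`, `v ∉ S'`, lies in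
`unramifiedOutside H A_ρ[N] p S₀` as soon as `S' ⊆ S₀ ∪ {v ∣ p}`: «unramified» is `Γ_ℚ`-stable in the all-primes form
(`forall_resLe_inf_inertia_conjMap_eq_zero`), `GreenbergSelmer.inertia v = I_{𝔓₀(v)}`, and B1.
[cite: GreenbergVatsal2000, §2 pp. 16–17, 23] [cite: Kato2004Asterisque, §8.2 (p. 181)] [cite: NeukirchANT1999, Ch. II §9 (9.6)] -/
theorem mem_unramifiedOutside_of_admissible (H : Subgroup (absoluteGaloisGroup ℚ)) [H.Normal]
    {S₀ S' : Set (HeightOneSpectrum (𝓞 ℚ))} (hS' : S' ⊆ S₀ ∪ {v | ((p : ℕ) : 𝓞 ℚ) ∈ v.asIdeal})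
    {c : subgroupH1 H ↥(AddSubgroup.torsionBy (Cofree ρ ↥(padicCoeffField S)) N)}
    (hc : ∀ v ∉ S', ∀ 𝔓 ∈ v.primesAbove,
      resLe (cofreeTorsionGaloisModule S ρ N).toTopRep (inf_le_left : H ⊓ 𝔓.inertia (absoluteGaloisGroup ℚ) ≤ H) 1 c = 0) :
    c ∈ unramifiedOutside H ↥(AddSubgroup.torsionBy (Cofree ρ ↥(padicCoeffField S)) N) p S₀ := by
  rw [GreenbergVatsal2000.mem_unramifiedOutside_iff]
  intro v hvS hvp σ
  have hv : v ∉ S' := fun h ↦ (hS' h).elim hvS hvp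
  -- all primes above `v`: `conj_σ c` dies on `H ⊓ I_{𝔓₀(v)}` (Kato's dialect `resLe`/`conjMap`, definitionally `resOfLe`/`conjH1`)
  have h1 := forall_resLe_inf_inertia_conjMap_eq_zero (cofreeTorsionGaloisModule S ρ N).toTopRep H v σ (hc v hv)
    (adicCompletionPrime ℚ v) (adicCompletionPrime_mem_primesAbove ℚ v)
  refine mem_unramifiedKer_of_resOfLe_inertia_inf_eq_zero H v (I := (adicCompletionPrime ℚ v).inertia (absoluteGaloisGroup ℚ))
    ?_ h1
  rw [inertia_adicCompletionPrime_eq_map_absInertia ℚ v]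
  exact le_rfl

variable {S₀ S' : Set (HeightOneSpectrum (𝓞 ℚ))}

/-- **T1 [unr].** An admissible level class transfers into clause (1) of the relaxed Selmer set over `ℚ_∞`:
`τ_{n,N} b ∈ unramifiedOutside Γ_∞ A_ρ p S₀`. [cite: GreenbergVatsal2000, §2 pp. 16–17, 23] [cite: SerreGaloisCohomology1997, I §2.4] -/
theorem transferH1_mem_unramifiedOutside (hS' : S' ⊆ S₀ ∪ {v | ((p : ℕ) : 𝓞 ℚ) ∈ v.asIdeal})
    {b : subgroupH1 (κ.layerSubgroup n) ↥(AddSubgroup.torsionBy (Cofree ρ ↥(padicCoeffField S)) N)}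
    (hb : ∀ v ∉ S', ∀ 𝔓 ∈ v.primesAbove, resLe (cofreeTorsionGaloisModule S ρ N).toTopRep
      (inf_le_left : κ.layerSubgroup n ⊓ 𝔓.inertia (absoluteGaloisGroup ℚ) ≤ κ.layerSubgroup n) 1 b = 0) :
    transferH1 S ρ κ N n b ∈ unramifiedOutside κ.kerSubgroup (Cofree ρ ↥(padicCoeffField S)) p S₀ :=
  ResidualLayer.resOfLe_mem_unramifiedOutside p S₀ (κ.kerSubgroup_le_layerSubgroup n)
    (ThetaTransport.pushH1_mem_unramifiedOutside _ (torsionBy_subtype_smul S ρ N) p S₀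
      (mem_unramifiedOutside_of_admissible S ρ N (κ.layerSubgroup n) hS' hb))

/-! ## §3 T2 [inf] and T3 [at `p`]: local triviality of all conjugates transfers -/

/-- **RES-PUSH-ZERO for `τ`.** If `conj_σ b` dies on `Γ_n ⊓ D` then `conj_σ (τ b)` dies on `Γ_∞ ⊓ D`.
[cite: NeukirchSchmidtWingberg2008, I §5] -/
theorem resOfLe_inf_conjH1_transferH1_eq_zero (D : Subgroup (absoluteGaloisGroup ℚ)) (σ : absoluteGaloisGroup ℚ)
    (b : subgroupH1 (κ.layerSubgroup n) ↥(AddSubgroup.torsionBy (Cofree ρ ↥(padicCoeffField S)) N))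
    (hb : resOfLe ↥(AddSubgroup.torsionBy (Cofree ρ ↥(padicCoeffField S)) N)
      (inf_le_left : κ.layerSubgroup n ⊓ D ≤ κ.layerSubgroup n)
      (conjH1 (κ.layerSubgroup n) ↥(AddSubgroup.torsionBy (Cofree ρ ↥(padicCoeffField S)) N) σ b) = 0) :
    resOfLe (Cofree ρ ↥(padicCoeffField S)) (inf_le_left : κ.kerSubgroup ⊓ D ≤ κ.kerSubgroup)
      (conjH1 κ.kerSubgroup (Cofree ρ ↥(padicCoeffField S)) σ (transferH1 S ρ κ N n b)) = 0 := by
  rw [transferH1, AddMonoidHom.comp_apply, conjH1_resOfLe, ThetaTransport.conjH1_pushH1]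
  exact resOfLe_inf_resOfLe_pushH1_eq_zero (κ.kerSubgroup_le_layerSubgroup n) D _ (torsionBy_subtype_smul S ρ N) hb

/-- **T2 [inf].** (E1c) at level `Γ_n` ⟹ clause (2) over `ℚ_∞`: `conj_σ (τ b) ∈ infKer Γ_∞ A_ρ w`.
[cite: Greenberg1989, §1 p. 98 (3)] -/
theorem conjH1_transferH1_mem_infKer (w : InfinitePlace ℚ) (σ : absoluteGaloisGroup ℚ)
    (b : subgroupH1 (κ.layerSubgroup n) ↥(AddSubgroup.torsionBy (Cofree ρ ↥(padicCoeffField S)) N))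
    (hb : resOfLe ↥(AddSubgroup.torsionBy (Cofree ρ ↥(padicCoeffField S)) N)
      (inf_le_left : κ.layerSubgroup n ⊓ GreenbergSelmer.decompInf w ≤ κ.layerSubgroup n)
      (conjH1 (κ.layerSubgroup n) ↥(AddSubgroup.torsionBy (Cofree ρ ↥(padicCoeffField S)) N) σ b) = 0) :
    conjH1 κ.kerSubgroup (Cofree ρ ↥(padicCoeffField S)) σ (transferH1 S ρ κ N n b) ∈
      infKer κ.kerSubgroup (Cofree ρ ↥(padicCoeffField S)) w := by
  rw [GreenbergSelmer.infKer, AddMonoidHom.mem_ker]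
  exact resOfLe_inf_conjH1_transferH1_eq_zero S ρ κ N n _ σ b hb

/-- **T3 [at `p`] (item 7: «`loc₂ s = 0`», strongest Galois-side form).** (E1b) at `v` ⟹
`conj_σ (τ b) ∈ awayKer Γ_∞ A_ρ v` for every `σ`. [cite: Greenberg1989, §1 p. 98] [cite: EmertonPollackWeston2006, §3.1] -/
theorem conjH1_transferH1_mem_awayKer (v : HeightOneSpectrum (𝓞 ℚ)) (σ : absoluteGaloisGroup ℚ)
    (b : subgroupH1 (κ.layerSubgroup n) ↥(AddSubgroup.torsionBy (Cofree ρ ↥(padicCoeffField S)) N))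
    (hb : resOfLe ↥(AddSubgroup.torsionBy (Cofree ρ ↥(padicCoeffField S)) N)
      (inf_le_left : κ.layerSubgroup n ⊓ GreenbergSelmer.decomp v ≤ κ.layerSubgroup n)
      (conjH1 (κ.layerSubgroup n) ↥(AddSubgroup.torsionBy (Cofree ρ ↥(padicCoeffField S)) N) σ b) = 0) :
    conjH1 κ.kerSubgroup (Cofree ρ ↥(padicCoeffField S)) σ (transferH1 S ρ κ N n b) ∈
      awayKer κ.kerSubgroup (Cofree ρ ↥(padicCoeffField S)) v := by
  rw [GreenbergSelmer.awayKer, AddMonoidHom.mem_ker]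
  exact resOfLe_inf_conjH1_transferH1_eq_zero S ρ κ N n _ σ b hb

/-- **Item 7, clauses (3)/(3♭) come for free.** Under (E1b) at `v`, `conj_σ (τ b)` has a representative cocycle VANISHING on
`Γ_∞ ∩ D_v` (B2 with `isOpen_stabilizer_cofree`); by B3 the Kummer identity of RSL_g's clause (3) then holds with the zero points
`Q = 0` (pins `Θ`, `pointsMapOfEmb`, `resGalSubgroupOfEmb` — whose image lies in `Γ_∞ ∩ D_v` up to the conjugation already
quantified — are the lead's; not typed here). [cite: SerreGaloisCohomology1997, I §2.6 (b)] [cite: Greenberg1989, §1 p. 98] -/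
theorem exists_rep_vanishing_conjH1_transferH1 (v : HeightOneSpectrum (𝓞 ℚ)) (σ : absoluteGaloisGroup ℚ)
    (b : subgroupH1 (κ.layerSubgroup n) ↥(AddSubgroup.torsionBy (Cofree ρ ↥(padicCoeffField S)) N))
    (hb : resOfLe ↥(AddSubgroup.torsionBy (Cofree ρ ↥(padicCoeffField S)) N)
      (inf_le_left : κ.layerSubgroup n ⊓ GreenbergSelmer.decomp v ≤ κ.layerSubgroup n)
      (conjH1 (κ.layerSubgroup n) ↥(AddSubgroup.torsionBy (Cofree ρ ↥(padicCoeffField S)) N) σ b) = 0) :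
    ∃ ψ : contOneCocycles (discreteTopRep κ.kerSubgroup (Cofree ρ ↥(padicCoeffField S))),
      oneCocycleClass _ ψ = conjH1 κ.kerSubgroup (Cofree ρ ↥(padicCoeffField S)) σ (transferH1 S ρ κ N n b) ∧
      ∀ g : κ.kerSubgroup, (g : absoluteGaloisGroup ℚ) ∈ GreenbergSelmer.decomp v → ψ.1 g = 0 :=
  exists_rep_vanishing_of_resOfLe_inf_eq_zero κ.kerSubgroup (GreenbergSelmer.decomp v) (isOpen_stabilizer_cofree S ρ)
    (resOfLe_inf_conjH1_transferH1_eq_zero S ρ κ N n _ σ b hb)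

/-! ## §4 (T)_ρ assembled -/

/-- **(T)_ρ for items 6 and 7.** A level-`(n,N)` class that is admissible outside `S' ⊆ S₀ ∪ {v ∣ p}` (E1a) and all of
whose conjugates die on `Γ_n ∩ D_w` for every infinite `w` (E1c) transfers into the RELAXED Selmer set over `ℚ_∞`
(clauses (1) ∧ (2) of RSL_g's counted set, verbatim). [cite: GreenbergVatsal2000, §2] [cite: Greenberg1989, §1 p. 98 (3)]
[cite: PerrinRiou1994Asterisque229, §1.3] -/
theorem transferH1_mem_relaxed (hS' : S' ⊆ S₀ ∪ {v | ((p : ℕ) : 𝓞 ℚ) ∈ v.asIdeal})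
    (b : subgroupH1 (κ.layerSubgroup n) ↥(AddSubgroup.torsionBy (Cofree ρ ↥(padicCoeffField S)) N))
    (hE1a : ∀ v ∉ S', ∀ 𝔓 ∈ v.primesAbove, resLe (cofreeTorsionGaloisModule S ρ N).toTopRep
      (inf_le_left : κ.layerSubgroup n ⊓ 𝔓.inertia (absoluteGaloisGroup ℚ) ≤ κ.layerSubgroup n) 1 b = 0)
    (hE1c : ∀ (w : InfinitePlace ℚ) (σ : absoluteGaloisGroup ℚ),
      resOfLe ↥(AddSubgroup.torsionBy (Cofree ρ ↥(padicCoeffField S)) N)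
        (inf_le_left : κ.layerSubgroup n ⊓ GreenbergSelmer.decompInf w ≤ κ.layerSubgroup n)
        (conjH1 (κ.layerSubgroup n) ↥(AddSubgroup.torsionBy (Cofree ρ ↥(padicCoeffField S)) N) σ b) = 0) :
    transferH1 S ρ κ N n b ∈
      {y : subgroupH1 κ.kerSubgroup (Cofree ρ ↥(padicCoeffField S)) |
        y ∈ unramifiedOutside κ.kerSubgroup (Cofree ρ ↥(padicCoeffField S)) p S₀ ∧
        ∀ w σ, conjH1 κ.kerSubgroup (Cofree ρ ↥(padicCoeffField S)) σ y ∈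
          infKer κ.kerSubgroup (Cofree ρ ↥(padicCoeffField S)) w} :=
  ⟨transferH1_mem_unramifiedOutside S ρ κ N n hS' hE1a,
    fun w σ ↦ conjH1_transferH1_mem_infKer S ρ κ N n w σ _ (hE1c w σ)⟩

/-- **(T)_ρ for item 7 (strict at `p`).** Adding (E1b) at the places `v ∣ p`, the transferred class is moreover
trivial at `p` in the strongest sense: every conjugate lies in `awayKer Γ_∞ A_ρ v` — so any pinned `loc₂`
(restriction along a decomposition group above `2` inside `Γ_∞`) vanishes on it.
[cite: Greenberg1989, §1 p. 98] [cite: MilneADT2006, I 4.10 (b)] -/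
theorem transferH1_mem_relaxed_strict (hS' : S' ⊆ S₀ ∪ {v | ((p : ℕ) : 𝓞 ℚ) ∈ v.asIdeal})
    (b : subgroupH1 (κ.layerSubgroup n) ↥(AddSubgroup.torsionBy (Cofree ρ ↥(padicCoeffField S)) N))
    (hE1a : ∀ v ∉ S', ∀ 𝔓 ∈ v.primesAbove, resLe (cofreeTorsionGaloisModule S ρ N).toTopRep
      (inf_le_left : κ.layerSubgroup n ⊓ 𝔓.inertia (absoluteGaloisGroup ℚ) ≤ κ.layerSubgroup n) 1 b = 0)
    (hE1c : ∀ (w : InfinitePlace ℚ) (σ : absoluteGaloisGroup ℚ),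
      resOfLe ↥(AddSubgroup.torsionBy (Cofree ρ ↥(padicCoeffField S)) N)
        (inf_le_left : κ.layerSubgroup n ⊓ GreenbergSelmer.decompInf w ≤ κ.layerSubgroup n)
        (conjH1 (κ.layerSubgroup n) ↥(AddSubgroup.torsionBy (Cofree ρ ↥(padicCoeffField S)) N) σ b) = 0)
    (hE1b : ∀ (v : HeightOneSpectrum (𝓞 ℚ)), ((p : ℕ) : 𝓞 ℚ) ∈ v.asIdeal → ∀ σ : absoluteGaloisGroup ℚ,
      resOfLe ↥(AddSubgroup.torsionBy (Cofree ρ ↥(padicCoeffField S)) N)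
        (inf_le_left : κ.layerSubgroup n ⊓ GreenbergSelmer.decomp v ≤ κ.layerSubgroup n)
        (conjH1 (κ.layerSubgroup n) ↥(AddSubgroup.torsionBy (Cofree ρ ↥(padicCoeffField S)) N) σ b) = 0) :
    transferH1 S ρ κ N n b ∈
      {y : subgroupH1 κ.kerSubgroup (Cofree ρ ↥(padicCoeffField S)) |
        y ∈ unramifiedOutside κ.kerSubgroup (Cofree ρ ↥(padicCoeffField S)) p S₀ ∧
        (∀ w σ, conjH1 κ.kerSubgroup (Cofree ρ ↥(padicCoeffField S)) σ y ∈
          infKer κ.kerSubgroup (Cofree ρ ↥(padicCoeffField S)) w) ∧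
        ∀ v, ((p : ℕ) : 𝓞 ℚ) ∈ v.asIdeal → ∀ σ, conjH1 κ.kerSubgroup (Cofree ρ ↥(padicCoeffField S)) σ y ∈
          awayKer κ.kerSubgroup (Cofree ρ ↥(padicCoeffField S)) v} :=
  ⟨transferH1_mem_unramifiedOutside S ρ κ N n hS' hE1a,
    fun w σ ↦ conjH1_transferH1_mem_infKer S ρ κ N n w σ _ (hE1c w σ),
    fun v hv σ ↦ conjH1_transferH1_mem_awayKer S ρ κ N n v σ _ (hE1b v hv σ)⟩

/-! ## §4b From the DUAL SELMER STRUCTURE at level `(n,N)` (Shapiro model over `K = ℚ`, S52/S53) to the relaxed set over `ℚ_∞`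

The composite with the landed `…CofreeShapiroTransport` §2–§3: the hypotheses are now LOCAL CONDITIONS on the global Shapiro lift
`Sh c ∈ H¹(ℚ, Maps(Γ_ℚ ⧸ Γ_n, A_ρ[N]))` — unramified at the finite `w ∉ S₀ ∪ {p}`, zero at the infinite place(s) [and zero at `v ∣ p`
for item 7] — i.e. membership of `Sh c` in the DUAL structure of the level-`(n,N)` `SelmerComplement` call (relaxed at `S₀`, hence no
hypothesis there).  On the RSL_g habitat `S₀ ⊇ {v : ℓ_v ∣ M} ∪ {bad places of W}` and `ρ` is unramified at `ℓ ∤ 2M`, so `hρ` holds. -/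

section Shapiro

open Literature.NumberTheory.GaloisRepresentations.DiscreteGaloisModule Literature.NumberTheory.GaloisCohomology

variable [Fintype (absoluteGaloisGroup ℚ ⧸ κ.layerSubgroup n)]
  {s : absoluteGaloisGroup ℚ ⧸ κ.layerSubgroup n → absoluteGaloisGroup ℚ}
  (hs : ∀ x : absoluteGaloisGroup ℚ ⧸ κ.layerSubgroup n, (s x : absoluteGaloisGroup ℚ ⧸ κ.layerSubgroup n) = x)
  (hs1 : s ((1 : absoluteGaloisGroup ℚ) : absoluteGaloisGroup ℚ ⧸ κ.layerSubgroup n) = 1)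

/-- **Dual structure ⟹ relaxed set (items 6 and 7).** [cite: NeukirchSchmidtWingberg2008, I §6 Prop. (1.6.4)] [cite: MilneADT2006, I §4]
[cite: GreenbergVatsal2000, §2 pp. 16–17, 23] [cite: Greenberg1989, §1 p. 98 (3)] -/
theorem transferH1_mem_relaxed_of_shapiroLift
    (hρ : ∀ w : HeightOneSpectrum (𝓞 ℚ), w ∉ S₀ → ((p : ℕ) : 𝓞 ℚ) ∉ w.asIdeal → ρ.IsUnramifiedAt w)
    (c : H1 (cofreeTorsionGaloisModule S ρ N) (κ.layerSubgroup n))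
    (hur : ∀ w : HeightOneSpectrum (𝓞 ℚ), w ∉ S₀ → ((p : ℕ) : 𝓞 ℚ) ∉ w.asIdeal →
      galoisCohomology.localization
          ((cofreeTorsionGaloisModule S ρ N).coind (κ.layerSubgroup n) (κ.isOpen_layerSubgroup n)) (Sum.inr w) 1
          (shapiroLift (cofreeTorsionGaloisModule S ρ N).toTopRep (κ.layerSubgroup n) (κ.isOpen_layerSubgroup n) hs hs1 c) ∈
        unramifiedSubgroup (GaloisRep.toLocal w
          ((cofreeTorsionGaloisModule S ρ N).coind (κ.layerSubgroup n) (κ.isOpen_layerSubgroup n))) 1)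
    (hinf : ∀ w : InfinitePlace ℚ,
      galoisCohomology.localization
          ((cofreeTorsionGaloisModule S ρ N).coind (κ.layerSubgroup n) (κ.isOpen_layerSubgroup n)) (Sum.inl w) 1
          (shapiroLift (cofreeTorsionGaloisModule S ρ N).toTopRep (κ.layerSubgroup n) (κ.isOpen_layerSubgroup n) hs hs1 c) = 0) :
    transferH1 S ρ κ N n c ∈
      {y : subgroupH1 κ.kerSubgroup (Cofree ρ ↥(padicCoeffField S)) |
        y ∈ unramifiedOutside κ.kerSubgroup (Cofree ρ ↥(padicCoeffField S)) p S₀ ∧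
        ∀ w σ, conjH1 κ.kerSubgroup (Cofree ρ ↥(padicCoeffField S)) σ y ∈
          infKer κ.kerSubgroup (Cofree ρ ↥(padicCoeffField S)) w} := by
  refine transferH1_mem_relaxed S ρ κ N n (S' := S₀ ∪ {v | ((p : ℕ) : 𝓞 ℚ) ∈ v.asIdeal}) subset_rfl c ?_ fun w σ ↦ ?_
  · refine ThetaTransport.ShapiroTransport.admissible_of_forall_localization_shapiroLift_mem S ρ κ N n hs hs1
      (fun w hw ↦ ?_) c (fun w hw ↦ ?_)
    · simp only [Set.mem_union, Set.mem_setOf_eq, not_or] at hw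
      exact ⟨hw.2, hρ w hw.1 hw.2⟩
    · simp only [Set.mem_union, Set.mem_setOf_eq, not_or] at hw
      exact hur w hw.1 hw.2
  · exact ThetaTransport.ShapiroTransport.resOfLe_decompInf_conjH1_eq_zero_of_localization_shapiroLift_eq_zero S ρ N κ n hs hs1
      w c (hinf w) σ

/-- **Dual structure ⟹ relaxed set, strict at `p` (item 7).** [cite: NeukirchSchmidtWingberg2008, I §6 Prop. (1.6.4)]
[cite: Greenberg1989, §1 p. 98] [cite: MilneADT2006, I 4.10 (b)] -/
theorem transferH1_mem_relaxed_strict_of_shapiroLift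
    (hρ : ∀ w : HeightOneSpectrum (𝓞 ℚ), w ∉ S₀ → ((p : ℕ) : 𝓞 ℚ) ∉ w.asIdeal → ρ.IsUnramifiedAt w)
    (c : H1 (cofreeTorsionGaloisModule S ρ N) (κ.layerSubgroup n))
    (hur : ∀ w : HeightOneSpectrum (𝓞 ℚ), w ∉ S₀ → ((p : ℕ) : 𝓞 ℚ) ∉ w.asIdeal →
      galoisCohomology.localization
          ((cofreeTorsionGaloisModule S ρ N).coind (κ.layerSubgroup n) (κ.isOpen_layerSubgroup n)) (Sum.inr w) 1
          (shapiroLift (cofreeTorsionGaloisModule S ρ N).toTopRep (κ.layerSubgroup n) (κ.isOpen_layerSubgroup n) hs hs1 c) ∈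
        unramifiedSubgroup (GaloisRep.toLocal w
          ((cofreeTorsionGaloisModule S ρ N).coind (κ.layerSubgroup n) (κ.isOpen_layerSubgroup n))) 1)
    (hinf : ∀ w : InfinitePlace ℚ,
      galoisCohomology.localization
          ((cofreeTorsionGaloisModule S ρ N).coind (κ.layerSubgroup n) (κ.isOpen_layerSubgroup n)) (Sum.inl w) 1
          (shapiroLift (cofreeTorsionGaloisModule S ρ N).toTopRep (κ.layerSubgroup n) (κ.isOpen_layerSubgroup n) hs hs1 c) = 0)
    (hp : ∀ v : HeightOneSpectrum (𝓞 ℚ), ((p : ℕ) : 𝓞 ℚ) ∈ v.asIdeal →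
      galoisCohomology.localization
          ((cofreeTorsionGaloisModule S ρ N).coind (κ.layerSubgroup n) (κ.isOpen_layerSubgroup n)) (Sum.inr v) 1
          (shapiroLift (cofreeTorsionGaloisModule S ρ N).toTopRep (κ.layerSubgroup n) (κ.isOpen_layerSubgroup n) hs hs1 c) = 0) :
    transferH1 S ρ κ N n c ∈
      {y : subgroupH1 κ.kerSubgroup (Cofree ρ ↥(padicCoeffField S)) |
        y ∈ unramifiedOutside κ.kerSubgroup (Cofree ρ ↥(padicCoeffField S)) p S₀ ∧
        (∀ w σ, conjH1 κ.kerSubgroup (Cofree ρ ↥(padicCoeffField S)) σ y ∈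
          infKer κ.kerSubgroup (Cofree ρ ↥(padicCoeffField S)) w) ∧
        ∀ v, ((p : ℕ) : 𝓞 ℚ) ∈ v.asIdeal → ∀ σ, conjH1 κ.kerSubgroup (Cofree ρ ↥(padicCoeffField S)) σ y ∈
          awayKer κ.kerSubgroup (Cofree ρ ↥(padicCoeffField S)) v} := by
  obtain ⟨h1, h2⟩ := transferH1_mem_relaxed_of_shapiroLift S ρ κ N n hs hs1 hρ c hur hinf
  exact ⟨h1, h2, fun v hv σ ↦ conjH1_transferH1_mem_awayKer S ρ κ N n v σ _
    (ThetaTransport.ShapiroTransport.resOfLe_decomp_conjH1_eq_zero_of_localization_shapiroLift_eq_zero S ρ N κ n hs hs1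
      v c (hp v hv) σ)⟩

end Shapiro

/-! ## §5 GLUE: Λ-adic orthogonality + (T)_ρ + readback ⟹ levelwise orthogonality (hypothesis (ii)) -/

section Glue

variable {Hn Hinf R : Type*} [Zero R]

/-- **GLUE-67 (items 6/7, the provable glue of the decomposition).** Abstractly: `Adm ⊆ Hn` the admissible level
classes (those satisfying (E1a)(E1c)[(E1b)]), `Rel ⊆ Hinf` the relaxed Λ-adic Selmer set, `τ : Hn → Hinf` the transfer
with (T) `τ '' Adm ⊆ Rel`, `C : Hinf → R` the Λ-adic functional `s ↦ c₂ z (loc₂ s)` (item 6) or `s ↦ cS χ (locS s)`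
(item 7) with the items' hypothesis (H) `C = 0` on `Rel`, and `P : Hn → R` the level-`(n,k)` local pairing
`b ↦ Σ_v ⟨t_v, loc_v Sh⁻¹ b⟩` with the READBACK (R) `P b = C (τ b)` on `Adm` (T4, pins).  Then `P = 0` on `Adm` —
hypothesis (ii) of the ONE `SelmerComplement` call per `(n,k)`. [cite: MilneADT2006, I 4.10 (b)] [cite: Rubin2000, App. B §B.3] -/
theorem levelwise_orthogonal_of_transfer (Adm : Set Hn) (Rel : Set Hinf) (τ : Hn → Hinf) (C : Hinf → R) (P : Hn → R)
    (hT : ∀ b ∈ Adm, τ b ∈ Rel) (hH : ∀ s ∈ Rel, C s = 0) (hR : ∀ b ∈ Adm, P b = C (τ b)) :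
    ∀ b ∈ Adm, P b = 0 :=
  fun b hb ↦ (hR b hb).trans (hH _ (hT b hb))

/-- **GLUE-7 (item 7's guarded hypothesis).** The same with the strictness guard: (H′) `C s = 0` only for `s ∈ Rel`
with `Str s` («`loc₂ s = 0`»), and (T′) `τ` maps `Adm` into `Rel ∩ Str` (§4 `transferH1_mem_relaxed_strict`).
[cite: MilneADT2006, I 4.10 (b)] -/
theorem levelwise_orthogonal_of_transfer_strict (Adm : Set Hn) (Rel Str : Set Hinf) (τ : Hn → Hinf) (C : Hinf → R)
    (P : Hn → R) (hT : ∀ b ∈ Adm, τ b ∈ Rel ∧ τ b ∈ Str) (hH : ∀ s ∈ Rel, s ∈ Str → C s = 0)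
    (hR : ∀ b ∈ Adm, P b = C (τ b)) : ∀ b ∈ Adm, P b = 0 :=
  fun b hb ↦ (hR b hb).trans (hH _ (hT b hb).1 (hT b hb).2)

end Glue

/-! ## §6 The transferred classes are `N`-torsion -/

/-- `N • (τ b) = 0`: `τ` is additive and `N • b = 0` in `H¹(Γ_n, A_ρ[N])` (the coefficients are killed by `N`).
[cite: SerreGaloisCohomology1997, I §2.2] -/
theorem zsmul_transferH1_eq_zero (b : subgroupH1 (κ.layerSubgroup n) ↥(AddSubgroup.torsionBy (Cofree ρ ↥(padicCoeffField S)) N))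
    (hb : N • b = 0) : N • transferH1 S ρ κ N n b = 0 := by
  rw [← map_zsmul, hb, map_zero]

end Summit.BirchSwinnertonDyer.BirchSwinnertonDyer.Cruxes.ResidualThetaCountLowerPureAtTwo.StubIdeasK3G13

end
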